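/- Copyright: the b2b-balaban cell (near-miss cell 7), T⁴-continuum fan-out; row NE7b ROUND-2 swarm, seat
t4-ne7b-formalise-leaf-06 (gen 7) (road W-RP, sub-row «W-LAB», file 1: the (EXT) event algebra read off by two FUNCTIONS of
the extended state — a term label and a cell labelling; INTENT journal l.17482).  Released under the licence of the
surrounding project. -/
import Summits.QuantumFields.BalabanUV.T4Continuum.Support.HistoryChessboardEventsSplit

/-!
# Road W-RP, sub-row «W-LAB», file 1: LABELLED EVENTS — term events and cell events as fibres of functions

Summits-side support leaf of the T⁴-continuum cell (rung (B)+1 on a FINITE torus only; NOT infinite volume, NOT the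
mass gap, NOT the Clay statement; NOT a proof of the spine estimate NE7b).  Row NE7b, road **W-RP** (owner's rulings
R-OWNER-23-2 ∕ R-OWNER-23-8: a LIVE SECONDARY road beside the COUNT road of record), on top of this lineage's event
model file 4a (`HistoryChessboardEventsSplit`: the event half `EventSide` of W4b′'s per-cutoff reading).  File 2
(`HistoryChessboardLabelsCubes`) is the cube-tower instance with W3n file 3 (`HistoryRPTowerColumnCubes`, leaf-07 g5).
[folklore] set algebra (fibres of functions over a finite block torus) over the cell's OWN carriers; ONE hypothesis
SHAPE `structure LabelSide … : Prop` (consumed only as a binder, exactly as 4a's `EventSide`); no definition of data, no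
`[cite:]` tag (nothing printed is stated), no `Prop`-valued FACT minted (c1), no constant (c2∕c6), no exit ∕ socket ∕
`HistoryConstants` file touched (c3).

WHY.  4a's `EventSide` displays its term events `ev τ` and cell events `E l c` as abstract SET families with four
consistency clauses (`ev_cover`, `bad_disj`, `bad_sub`, `sym`) — and W-E1's `reprA_of_repr` (leaf-01 g8,
`HistoryChessboardTowerRepr`) needs one clause 4a does NOT display: pairwise disjointness of ALL term events.  On road W
«a term IS an event of the normalised extended state»; the natural reading is by two FUNCTIONS of the state — a TERM
LABEL `term : Ω → ι` (which term the state belongs to) and a CELL LABELLING `lab : Ω → BlockIdx d N → Λ` (the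
field-size class of every cell) — with `ev τ := term ⁻¹' {τ}` and `E l c := {ω | lab ω c = l}`.  Then the four clauses
and the partition are THEOREMS of two pointwise sentences: `bad_lab` (a bad term forces a bad label in some cell) and
`equiv` (the labelling is reflection-equivariant); cover and disjointness are automatic (fibres of a function —
Mathlib's `Set.pairwiseDisjoint_fiber`).

WHAT.
* the fibre lemmas `cover_fibre`, `preimage_labelSet_eq`, `equiv_of_preimage` (the family
  of SET identities — W3o's `tEvent_sym` ∕ W3n-3's `sym_of_template` output shape — ⇔ the pointwise `equiv`),
  `iInter_univ_labelSet`, `fibre_subset_of_bad_lab`; `measurableSet_labelFibre`, `measurableSet_fibre_of_factor` (a term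
  label that FACTORS through the labelling is measurable from the single-cell label events; finite block torus, finite
  label alphabet — the supplier of `term_meas` for «the term of a state is a function of its pattern»);
* `structure LabelSide` (any carrier `Ω`, any reflections `θ` ∕ positive algebras `mP`); its (EXT) clauses as theorems
  `LabelSide.ev_meas ∕ ev_cover ∕ ev_disj ∕ bad_disj ∕ bad_sub ∕ sym` (the first three = W-E1's `hmeas`∕`hcover`∕`hdisj`
  shapes at `ev := (term ⁻¹' {·})`), and **`LabelSide.eventSide`** — 4a's `EventSide` for the fibre events
  (+ `LabelSide.cutoffReading`: W4b′'s full reading given `prob` and the RP five, 4a's junction).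

HONEST SCOPE (R-OWNER-23-8 wording for road W-RP).  Regrouping: what an instantiating seat still DISPLAYS for a labelled
reading is WHICH labelling (that Bałaban's large-field classes per cell ARE such labels and his expansion terms such
fibres — in print the terms carry 𝐑-operations and analytic continuations, not bare characteristic functions: (EXT)
proper), `repr` (weights = source-dressed fibre masses), `bad_lab`, `equiv`, `lab_meas`∕`loc` (file 2: from the cube
column), `univ_le` ((U1)+(G2)), and NE7c ∕ NE7 ∕ the rates downstream; nothing of H3 ∕ (B) ∕ BetaPertH is discharged; the
count 0∕9 is unchanged.  NE7b NOT proved; spine 0∕9.  HONEST DEPENDENCY (cell): continuum YM on T⁴ ⇐ BetaPertH ∧ nine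
spine estimates (0/9 proved); BetaPertH ⇐ (D1) ∧ (D4) ∧ CAP+tail; G-an2-4 gates asym, D1 and NE2/3/4.  This file changes
none of it.
-/


open Finset MeasureTheory Literature.Barriers.CriticalPhenomena.NonGibbs
open Literature.MathematicalPhysics.QuantumFieldTheory.LatticeRP (IsReflectionPositiveBdd)
open Summit.QuantumFields.BalabanUV.T4Continuum HistoryChessboardAssembly HistoryChessboardEvents
open HistoryChessboardEventsCutoff HistoryChessboardEventsSplit

namespace Summit.QuantumFields.BalabanUV.T4Continuum.HistoryChessboardLabels

noncomputable section

/-! ## §1 Fibres of functions on any carrier -/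

section Fibres

variable {Ω ι Λ : Type*} {d N : ℕ}

/-- **EVERY STATE HAS ITS TERM**: the fibres of a term label with values in `T` cover the carrier (4a's `ev_cover` shape).
[folklore] -/
theorem cover_fibre {term : Ω → ι} {T : Finset ι} (h : ∀ ω, term ω ∈ T) : Set.univ ⊆ ⋃ τ ∈ T, term ⁻¹' {τ} :=
  fun ω _ => Set.mem_iUnion₂.2 ⟨term ω, h ω, rfl⟩

/-- **AN EQUIVARIANT LABELLING HAS REFLECTION-RELATED LABEL EVENTS** (4a's `sym` shape for `E l c := {ω | lab ω c = l}`).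
[folklore] -/
theorem preimage_labelSet_eq {lab : Ω → BlockIdx d N → Λ} {θ : Fin d → ZMod N → Ω → Ω}
    (h : ∀ (i : Fin d) (k : ZMod N) (c : BlockIdx d N) (ω : Ω), lab (θ i k ω) c = lab ω (cellReflect i k c))
    (l : Λ) (i : Fin d) (k : ZMod N) (c : BlockIdx d N) :
    θ i k ⁻¹' {ω | lab ω c = l} = {ω | lab ω (cellReflect i k c) = l} :=
  Set.ext fun ω => by rw [Set.mem_preimage, Set.mem_setOf_eq, Set.mem_setOf_eq, h]

/-- **CONVERSELY**: if for EVERY label the label events are reflection-related (the family of set identities a template ∕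
column supplier delivers — W3o's `tEvent_sym`, W3n-3's `sym_of_template` output shape), the labelling is equivariant.
[folklore] -/
theorem equiv_of_preimage {lab : Ω → BlockIdx d N → Λ} {θ : Fin d → ZMod N → Ω → Ω}
    (h : ∀ (l : Λ) (i : Fin d) (k : ZMod N) (c : BlockIdx d N),
      θ i k ⁻¹' {ω | lab ω c = l} = {ω | lab ω (cellReflect i k c) = l}) :
    ∀ (i : Fin d) (k : ZMod N) (c : BlockIdx d N) (ω : Ω), lab (θ i k ω) c = lab ω (cellReflect i k c) := by
  intro i k c ω
  have hω : ω ∈ θ i k ⁻¹' {ω' | lab ω' c = lab (θ i k ω) c} := rfl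
  rw [h] at hω
  exact (show lab ω (cellReflect i k c) = lab (θ i k ω) c from hω).symm

/-- the «every cell carries the label `l`» event, as 4a's `univ_le` reads it (an intersection over `Finset.univ`).
[folklore] -/
theorem iInter_univ_labelSet [NeZero N] (lab : Ω → BlockIdx d N → Λ) (l : Λ) :
    (⋂ c ∈ (Finset.univ : Finset (BlockIdx d N)), {ω | lab ω c = l}) = {ω | ∀ c, lab ω c = l} :=
  Set.ext fun ω => by simp only [Set.mem_iInter, Finset.mem_univ, forall_true_left, Set.mem_setOf_eq]

/-- **A BAD TERM LIES IN A BAD-LABEL CELL EVENT** (4a's `bad_sub` shape) once, pointwise, a bad term forces a bad label in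
some cell. [folklore] -/
theorem fibre_subset_of_bad_lab {term : Ω → ι} {lab : Ω → BlockIdx d N → Λ} {P : Finset Λ} {Bad : Finset ι}
    (h : ∀ ω, term ω ∈ Bad → ∃ c, lab ω c ∈ P) :
    ∀ τ ∈ Bad, term ⁻¹' {τ} ⊆ ⋃ l ∈ P, ⋃ c : BlockIdx d N, {ω | lab ω c = l} := by
  intro τ hτ ω hω
  have hω' : term ω = τ := hω
  obtain ⟨c, hc⟩ := h ω (hω' ▸ hτ)
  exact Set.mem_iUnion₂.2 ⟨lab ω c, hc, Set.mem_iUnion.2 ⟨c, rfl⟩⟩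

variable [MeasurableSpace Ω]

/-- **THE FULL-PATTERN EVENTS ARE MEASURABLE** from the single-cell label events (finite block torus). [folklore] -/
theorem measurableSet_labelFibre [NeZero N] {lab : Ω → BlockIdx d N → Λ} (h : ∀ c l, MeasurableSet {ω | lab ω c = l})
    (p : BlockIdx d N → Λ) : MeasurableSet {ω | lab ω = p} := by
  have hp : {ω | lab ω = p} = ⋂ c, {ω | lab ω c = p c} :=
    Set.ext fun ω => by simp only [Set.mem_setOf_eq, Set.mem_iInter, funext_iff]
  rw [hp]
  exact MeasurableSet.iInter fun c => h c (p c)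

/-- **A TERM LABEL THAT FACTORS THROUGH THE LABELLING IS MEASURABLE** from the single-cell label events (finite block
torus, finite label alphabet): the supplier of `term_meas` for «the term of a state is a function of its pattern».
[folklore] -/
theorem measurableSet_fibre_of_factor [NeZero N] [Finite Λ] {lab : Ω → BlockIdx d N → Λ}
    (h : ∀ c l, MeasurableSet {ω | lab ω c = l}) (φ : (BlockIdx d N → Λ) → ι) (τ : ι) :
    MeasurableSet ((fun ω => φ (lab ω)) ⁻¹' {τ}) := by
  have hτ : (fun ω => φ (lab ω)) ⁻¹' {τ} = ⋃ p ∈ {p : BlockIdx d N → Λ | φ p = τ}, {ω | lab ω = p} := by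
    ext ω
    simp only [Set.mem_preimage, Set.mem_singleton_iff, Set.mem_iUnion, Set.mem_setOf_eq, exists_prop,
      exists_eq_right']
  rw [hτ]
  exact MeasurableSet.biUnion (Set.to_countable _) fun p _ => measurableSet_labelFibre h p

end Fibres

/-! ## §2 The labelled reading and 4a's event half -/

section Generic

variable {Ω ι Λ : Type*} [MeasurableSpace Ω] {d N : ℕ}

/-- **THE LABELLED READING** (road W-RP, sub-row «W-LAB»): 4a's event half `EventSide` for term events and cell events READ
OFF BY FUNCTIONS of the extended state — a term label `term : Ω → ι` (`ev τ := term ⁻¹' {τ}`) and a cell labelling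
`lab : Ω → BlockIdx d N → Λ` (`E l c := {ω | lab ω c = l}`).  4a's bookkeeping clauses verbatim (`Z_pos`, `bad_subset`,
`obs_meas`, `obs_bdd`, `ob_nonneg`, `repr`, `loc`, `univ_le`, `r_nonneg`, measurability of the events), and TWO pointwise
sentences in place of 4a's four set-algebra consistency clauses: `bad_lab` ((EXT)∘(LOC): a bad term forces a bad label
in some cell) and `equiv` ((R-sym): the labelling is reflection-equivariant).  A hypothesis SHAPE; NOTHING of Bałaban's
is asserted; no citation tag. [folklore] -/
structure LabelSide (d N : ℕ) [NeZero N] (P : Finset Λ) (T : Finset ι) (A : ℝ → ι → ℝ) (Bad : Finset ι)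
    (μ : Measure Ω) (Z : ℝ) (term : Ω → ι) (obs : Ω → ℝ) (ob : ℝ) (lab : Ω → BlockIdx d N → Λ)
    (θ : Fin d → ZMod N → Ω → Ω) (mP : Fin d → ZMod N → MeasurableSpace Ω) (r : ℝ) : Prop where
  /-- the undressed partition function is positive -/
  Z_pos : 0 < Z
  /-- the bad class consists of terms -/
  bad_subset : Bad ⊆ T
  /-- every state belongs to a term of `T` -/
  range : ∀ ω, term ω ∈ T
  /-- term events are measurable -/
  term_meas : ∀ τ ∈ T, MeasurableSet (term ⁻¹' {τ})
  /-- bad-label cell events are measurable -/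
  lab_meas : ∀ l ∈ P, ∀ c : BlockIdx d N, MeasurableSet {ω | lab ω c = l}
  /-- the source observable is measurable … -/
  obs_meas : Measurable obs
  /-- … and bounded by `ob` -/
  obs_bdd : ∀ ω, |obs ω| ≤ ob
  /-- the bound is nonnegative -/
  ob_nonneg : 0 ≤ ob
  /-- (EXT)+(DRESS): the dressed weight of a term is the source-dressed mass of its fibre -/
  repr : ∀ (t : ℝ), ∀ τ ∈ T, A t τ = Z * ∫ ω in term ⁻¹' {τ}, Real.exp (t * obs ω) ∂μ
  /-- (EXT)∘(LOC), pointwise: a state in a bad term carries a bad label in some cell -/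
  bad_lab : ∀ ω, term ω ∈ Bad → ∃ c, lab ω c ∈ P
  /-- (LOC): the bad-label events of positive-half cells are positive-half measurable -/
  loc : ∀ l ∈ P, ∀ (i : Fin d) (k : ZMod N), ∀ c ∈ halfPlus N i k, MeasurableSet[mP i k] {ω | lab ω c = l}
  /-- (R-sym), pointwise: the labelling is reflection-equivariant -/
  equiv : ∀ (i : Fin d) (k : ZMod N) (c : BlockIdx d N) (ω : Ω), lab (θ i k ω) c = lab ω (cellReflect i k c)
  /-- (U1)+(G2), ratio currency: the pattern «every cell carries the bad label `l`» has probability `≤ r^(N^d)` -/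
  univ_le : ∀ l ∈ P, μ.real {ω | ∀ c, lab ω c = l} ≤ r ^ (N ^ d)
  /-- the per-cell rate is nonnegative -/
  r_nonneg : 0 ≤ r

variable [NeZero N] {P : Finset Λ} {T : Finset ι} {A : ℝ → ι → ℝ} {Bad : Finset ι} {μ : Measure Ω} {Z : ℝ}
  {term : Ω → ι} {obs : Ω → ℝ} {ob : ℝ} {lab : Ω → BlockIdx d N → Λ} {θ : Fin d → ZMod N → Ω → Ω}
  {mP : Fin d → ZMod N → MeasurableSpace Ω} {r : ℝ}

/-- the term events are measurable (W-E1's `hmeas` shape). [folklore] -/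
theorem LabelSide.ev_meas (H : LabelSide d N P T A Bad μ Z term obs ob lab θ mP r) :
    ∀ τ ∈ T, MeasurableSet (term ⁻¹' {τ}) :=
  H.term_meas

/-- **THE TERM EVENTS COVER** (4a's `ev_cover`, W-E1's `hcover` shape). [folklore] -/
theorem LabelSide.ev_cover (H : LabelSide d N P T A Bad μ Z term obs ob lab θ mP r) :
    Set.univ ⊆ ⋃ τ ∈ T, term ⁻¹' {τ} :=
  cover_fibre H.range

/-- **ALL TERM EVENTS ARE PAIRWISE DISJOINT** — the partition clause W-E1's `reprA_of_repr` asks for (`hdisj` shape), one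
clause beyond what 4a's `EventSide` displays. [folklore] -/
theorem LabelSide.ev_disj (_H : LabelSide d N P T A Bad μ Z term obs ob lab θ mP r) :
    (↑T : Set ι).PairwiseDisjoint fun τ => term ⁻¹' {τ} :=
  Set.pairwiseDisjoint_fiber term _

/-- the bad events are pairwise disjoint (4a's `bad_disj`). [folklore] -/
theorem LabelSide.bad_disj (_H : LabelSide d N P T A Bad μ Z term obs ob lab θ mP r) :
    (↑Bad : Set ι).PairwiseDisjoint fun τ => term ⁻¹' {τ} :=
  Set.pairwiseDisjoint_fiber term _

/-- every bad event lies inside a bad-label cell event (4a's `bad_sub`). [folklore] -/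
theorem LabelSide.bad_sub (H : LabelSide d N P T A Bad μ Z term obs ob lab θ mP r) :
    ∀ τ ∈ Bad, term ⁻¹' {τ} ⊆ ⋃ l ∈ P, ⋃ c : BlockIdx d N, {ω | lab ω c = l} :=
  fibre_subset_of_bad_lab H.bad_lab

/-- the cell events are reflection-related (4a's `sym`). [folklore] -/
theorem LabelSide.sym (H : LabelSide d N P T A Bad μ Z term obs ob lab θ mP r) :
    ∀ l ∈ P, ∀ (i : Fin d) (k : ZMod N) (c : BlockIdx d N),
      θ i k ⁻¹' {ω | lab ω c = l} = {ω | lab ω (cellReflect i k c) = l} :=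
  fun l _ i k c => preimage_labelSet_eq H.equiv l i k c

/-- **THE LABELLED READING IS 4a's EVENT HALF** for the fibre events `ev τ := term ⁻¹' {τ}`, `E l c := {ω | lab ω c = l}`:
`ev_cover`, `bad_disj`, `bad_sub`, `sym` are the theorems above; the other eleven clauses are carried. [folklore] -/
theorem LabelSide.eventSide (H : LabelSide d N P T A Bad μ Z term obs ob lab θ mP r) :
    EventSide d N P T A Bad μ Z (fun τ => term ⁻¹' {τ}) obs ob (fun l c => {ω | lab ω c = l}) θ mP r where
  Z_pos := H.Z_pos
  bad_subset := H.bad_subset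
  ev_meas := H.term_meas
  E_meas := H.lab_meas
  obs_meas := H.obs_meas
  obs_bdd := H.obs_bdd
  ob_nonneg := H.ob_nonneg
  repr := H.repr
  ev_cover := H.ev_cover
  bad_disj := H.bad_disj
  bad_sub := H.bad_sub
  loc := H.loc
  sym := H.sym
  univ_le l hl := by
    rw [iInter_univ_labelSet]
    exact H.univ_le l hl
  r_nonneg := H.r_nonneg

/-- … hence W4b′'s full 21-clause `CutoffReading` for the fibre events, given `prob` and the RP half in W3m's five-conjunct
shape (4a's junction `EventSide.cutoffReading`). [folklore] -/
theorem LabelSide.cutoffReading (H : LabelSide d N P T A Bad μ Z term obs ob lab θ mP r) (hprob : IsProbabilityMeasure μ)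
    (h5 : (∀ (i : Fin d) (k : ZMod N), mP i k ≤ ‹MeasurableSpace Ω›) ∧
      (∀ (i : Fin d) (k : ZMod N), Measurable (θ i k)) ∧
      (∀ (i : Fin d) (k : ZMod N), MeasurePreserving (θ i k) μ μ) ∧
      (∀ (i : Fin d) (k : ZMod N), θ i k ∘ θ i k = id) ∧
      (∀ (i : Fin d) (k : ZMod N), IsReflectionPositiveBdd μ (mP i k) (θ i k))) :
    CutoffReading d N P T A Bad μ Z (fun τ => term ⁻¹' {τ}) obs ob (fun l c => {ω | lab ω c = l}) θ mP r :=
  H.eventSide.cutoffReading hprob h5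

end Generic

end

end Summit.QuantumFields.BalabanUV.T4Continuum.HistoryChessboardLabels
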